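import Summits.AtomisticToContinuum.Crystallization.Theorems.ReggeStarCoercivityDefectFreeCrystallizesLayeredGluing14

/-!
# The gluing lemma `LayeredGluing` (S5a of line `prestress-split-korn`, crux stmt-AtomisticToContinuum-13603)

`stub_layeredGluing : LayeredGluing` — for every separation `δ` and scale `(R, ε)` there are `η > 0` and `R'`
such that a `δ`-separated finite configuration all of whose particles within `R'` of particle `i` are good and
`η`-layered-near on their 2-balls is, after a translation, two-way `ε`-matched on `B(0, R)` with ONE rigid image of
ONE box template.  Potential-free discrete geometry; `Good` is never unfolded.

## Proof

* (i)+(iii) `layeredGluing_of_exactRigidity : ExactLayeredRigidity → LayeredGluing` — contradiction and compactness: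
  offending configurations for `η = 1/(n+1)`, `R' = n`, recentred; a local limit `Y` in the local matching topology
  (`exists_subseq_forall_eventually_ballMatch`); template compactness (`template_extraction`: isometries, words, heights in
  a compact product) makes `Y` EXACTLY layered on every open 2-ball (`exactNear_of_limit`); the exact global template of `Y`
  read back at finite `n` is the forbidden window.
* (ii) `exactLayeredRigidity_holds : ExactLayeredRigidity` — a nonempty set `Y ⊆ ℝ³` exactly layered on every open 2-ball is one
  rigid image of one box template:
  - Part II (`global_of_framed`): if every point carries an identity-framed exact template of spacing `a` (`AllFramed`), layers
    are full triangular lattices, adjacent lattice points read the same adjacent layers, and two `ℕ`-recursions assemble the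
    global word and heights.
  - generic step (`generic_step`): a half-known identity-framed structure at `q` plus ANY exact template at `q` gives an
    identity-framed template at `q`.  If the template's frame tilts the vertical, the hexagon lemma (`hexagon_lemma`: five
    coplanar equal-norm neighbour sites force ideal heights) and antipodal pairs make both templates cubic-ideal, the tilt is a
    cube diagonal (`nu_sq_of_two_up`, `ν₂² = 1/9`), low sites of the far layers (`low_site_up/down`) are read in the known
    region and pin the far layers (`gs_fullyCubic`), so `Y` is the cubic template near `q`; if the frame is vertical, the
    template is re-expressed in the identity frame (`reexpress`).
  - induction on layers (`halfFramedAt_up`, `layerFramed_up`, `framed_above`) and reflection in the horizontal plane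
    (`reflectZ`, `allFramed_of_layerFramed`); Stage A along the base layer (`inplane_step`, `layerFramed_of_framed`) from a point
    whose data are not cubic-ideal, or in Case I (all based templates cubic at their base, where every template is fully ideal,
    `fullyCubic_of_caseI`); normalisation of the frame by transport (`global_of_templateAt`).

The first block of definitions (`layeredPos`, `InBox`, `LayeredNear`, `LayeredGluing`) is pasted VERBATIM from the lead's
`ReggeStarCoercivityDefectFreeCrystallizesDefs.lean` (to be replaced by the import once that module is in the tree); the
second block are the Prop-valued helper predicates of this proof (to live in a Defs companion).  All `[folklore]`.
-/

noncomputable section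

open scoped BigOperators Classical InnerProductSpace
open Filter Topology

namespace Summit.AtomisticToContinuum.Crystallization.Theorems.PrestressSplitKorn

open Summit.AtomisticToContinuum.Crystallization.Theses
open Summit.AtomisticToContinuum.Crystallization.Theses.ReggeStarCoercivity
open Summit.AtomisticToContinuum.Crystallization.Theorems.DefectFreeCrystallizes.Negative.PredicateAPI
open Literature.MathematicalPhysics.StatisticalMechanics Literature.Geometry.DiscreteGeometry


section Sites

variable {a : ℝ} {s : ℤ → ℤ} {z : ℤ → ℝ}

section Assembly

/-- **Main reduction.** A based template at a point of `Y`, with non-cubic data or in Case I, makes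
`Y` globally ONE rigid image of ONE box template. -/
theorem global_of_templateAt {Y : Set (EuclideanSpace ℝ (Fin 3))} (hE : ∀ q ∈ Y, ExactNear Y q) {q₀ : EuclideanSpace ℝ (Fin 3)} {E : EuclideanSpace ℝ (Fin 3) ≃ₗᵢ[ℝ] (EuclideanSpace ℝ (Fin 3))}
    {a : ℝ} {s : ℤ → ℤ} {z : ℤ → ℝ} (hT : TemplateAt Y q₀ E a s z) (hcase : ¬ CubicAt a s z ∨ CaseI Y) :
    ∃ (S : ℤ → ℤ) (Z : ℤ → ℝ), InBox a Z ∧ IsHaggSeq S ∧ Y = {y | ∃ l, y = q₀ + E (layeredPos a S Z l)} := by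
  -- transport to the frame of the template
  set f : EuclideanSpace ℝ (Fin 3) → EuclideanSpace ℝ (Fin 3) := fun y => E.symm y + -E.symm q₀ with hf
  set g : EuclideanSpace ℝ (Fin 3) → EuclideanSpace ℝ (Fin 3) := fun y' => E y' + q₀ with hg
  have hgf : ∀ y, g (f y) = y := fun y => by simp [hf, hg]
  have hfg : ∀ y', f (g y') = y' := fun y' => by simp [hf, hg]
  have hf' : ∀ y, f y = E.symm (y - q₀) := fun y => by simp only [hf, map_sub]; abel
  set Y' : Set (EuclideanSpace ℝ (Fin 3)) := f '' Y with hY'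
  have hgY' : g '' Y' = Y := by
    rw [hY', Set.image_image]; simp [hgf]
  have hE' : ∀ q' ∈ Y', ExactNear Y' q' := by
    rintro _ ⟨q, hq, rfl⟩
    exact (hE q hq).map E.symm (-E.symm q₀)
  have hf0 : f q₀ = 0 := by simp [hf]
  -- the template becomes an identity framing at `0`
  obtain ⟨hbox, hs, hz0, hN1, hN2⟩ := hT
  have hF : FramedAt a Y' 0 s z := by
    refine ⟨hbox, hs, hz0, ?_, ?_⟩
    · rintro _ ⟨y, hy, rfl⟩ hd
      have hd' : dist y q₀ < 2 := by
        rw [dist_eq_norm, hf', sub_zero, LinearIsometryEquiv.norm_map, ← dist_eq_norm] at hd; exact hd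
      obtain ⟨l, hl⟩ := hN1 y hy hd'
      exact ⟨l, by rw [hf', hl, add_sub_cancel_left, LinearIsometryEquiv.symm_apply_apply, zero_add]⟩
    · intro l hl
      refine ⟨q₀ + E (layeredPos a s z l), hN2 l hl, ?_⟩
      rw [hf', add_sub_cancel_left, LinearIsometryEquiv.symm_apply_apply, zero_add]
  have hcase' : ¬ CubicAt a s z ∨ CaseI Y' := by
    rcases hcase with h | hI
    · exact Or.inl h
    · right
      intro q' hq' E' a₁ s₁ z₁ hT'
      have hT'' := hT'.map E q₀
      have himg : (fun y => E y + q₀) '' Y' = Y := hgY'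
      rw [himg] at hT''
      obtain ⟨y, hy, rfl⟩ := hq'
      have hgq : E (f y) + q₀ = y := hgf y
      rw [hgq] at hT''
      exact hI y hy _ _ _ _ hT''
  have hL := layerFramed_of_framed hE' hF hcase'
  have hA := allFramed_of_layerFramed hE' hL
  obtain ⟨S, Z, hboxZ, hS, -, hYeq⟩ := global_of_framed hA hF.mem
  refine ⟨S, Z, hboxZ, hS, ?_⟩
  ext y
  constructor
  · intro hy
    have : f y ∈ Y' := ⟨y, hy, rfl⟩
    rw [hYeq] at this
    obtain ⟨l, hl⟩ := this
    refine ⟨l, ?_⟩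
    rw [zero_add, hf'] at hl
    have := congrArg (fun v => q₀ + E v) hl
    simpa using this
  · rintro ⟨l, rfl⟩
    have : f (q₀ + E (layeredPos a S Z l)) ∈ Y' := by
      rw [hYeq]; exact ⟨l, by rw [hf', add_sub_cancel_left, LinearIsometryEquiv.symm_apply_apply, zero_add]⟩
    obtain ⟨y, hy, hyf⟩ := this
    have := congrArg g hyf
    rw [hgf, hgf] at this
    rw [← this]; exact hy

/-- **Exact local-to-global rigidity of box templates.** -/
theorem exactLayeredRigidity_holds : ExactLayeredRigidity := by
  intro Y hne _ hE
  -- from a based template with non-cubic data or in Case I, conclude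
  have conclude : ∀ {q₀ : EuclideanSpace ℝ (Fin 3)} {E : EuclideanSpace ℝ (Fin 3) ≃ₗᵢ[ℝ] (EuclideanSpace ℝ (Fin 3))} {a : ℝ} {s : ℤ → ℤ} {z : ℤ → ℝ},
      TemplateAt Y q₀ E a s z → (¬ CubicAt a s z ∨ CaseI Y) →
      ∃ (A : EuclideanSpace ℝ (Fin 3) →ₗᵢ[ℝ] (EuclideanSpace ℝ (Fin 3))) (t : EuclideanSpace ℝ (Fin 3)) (a : ℝ) (s : ℤ → ℤ) (z : ℤ → ℝ), InBox a z ∧ IsHaggSeq s ∧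
        Y = {y | ∃ l, y + t = A (layeredPos a s z l)} := by
    intro q₀ E a s z hT hcase
    obtain ⟨S, Z, hbox, hS, hYeq⟩ := global_of_templateAt hE hT hcase
    refine ⟨E.toLinearIsometry, -q₀, a, S, Z, hbox, hS, ?_⟩
    rw [hYeq]
    ext y
    simp only [Set.mem_setOf_eq, LinearIsometryEquiv.coe_toLinearIsometry]
    constructor
    · rintro ⟨l, rfl⟩; exact ⟨l, by abel⟩
    · rintro ⟨l, hl⟩; exact ⟨l, by rw [← hl]; abel⟩
  by_cases hII : ∃ q ∈ Y, ∃ (E : EuclideanSpace ℝ (Fin 3) ≃ₗᵢ[ℝ] (EuclideanSpace ℝ (Fin 3))) (a : ℝ) (s : ℤ → ℤ) (z : ℤ → ℝ),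
      TemplateAt Y q E a s z ∧ ¬ CubicAt a s z
  · obtain ⟨q, -, E, a, s, z, hT, hnc⟩ := hII
    exact conclude hT (Or.inl hnc)
  · have hI : CaseI Y := by
      intro q hq E a s z hT
      by_contra hc
      exact hII ⟨q, hq, E, a, s, z, hT, hc⟩
    obtain ⟨q₀, hq₀⟩ := hne
    obtain ⟨E, a, s, z, hT⟩ := exactNear_templateAt (hE q₀ hq₀) hq₀
    exact conclude hT (Or.inr hI)

/-- **THE GLUING LEMMA (S5a)**: `LayeredGluing` — compactness in the local matching topology plus the
exact local-to-global rigidity of box templates. -/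
theorem stub_layeredGluing : LayeredGluing :=
  layeredGluing_of_exactRigidity exactLayeredRigidity_holds

end Assembly

end Sites

end Summit.AtomisticToContinuum.Crystallization.Theorems.PrestressSplitKorn
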